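import Summits.RiemannHypothesis.RiemannHypothesis.Theorems.Splittings.LinearRayCuspDualSums
import Summits.RiemannHypothesis.RiemannHypothesis.Theorems.Splittings.LinearRayResidueCells

/-!
# Linear ray, cusp transformation IV — the sign of `Re Φ_ℂ(iy)` on `[0.35, π/8)` and the linear ray on `0 < |a| < π/8`
(part 4 of 4) Top term `= −s^{−9/2} e^{iπ/8} G₂(W₀)` exactly (`top_phase`), the other four terms bounded in norm
(`re_assembly_le`), numerics for `s = 2 sin 2ε ≤ 0.171`, `πK ≥ 28` ⇒ `CuspTransform.re_tsum_term_neg_of_ge`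
(`0.35 ≤ y < π/8`). With the tree's kernel theta cells on `[0.31945, 0.37]` (`ResidueSignCells.re_tsum_neg_mid`):
`re_tsum_neg_upper`, `coshIntegral_ne_zero_of_upper`, `not_hasOnlyRealZeros_linearFactorH_of_upper` (`0.31945 ≤ |a| < π/8`),
`exists_nonreal_zero_linearFactorH_of_lt_pi_div_eight` (`a ≠ 0`, `|a| < π/8`, outside the `10⁻⁴` gap at `a₀`).
Axioms: propext, Classical.choice, Quot.sound. No `def`s in this part.
HONEST LABEL: a refutation of an RH-STRENGTHENING conjunct (the linear-factor ray); RH-free; nothing here bears on the truth of RH.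
Provenance: rh-splitx-eng-5 g2 (cell rh-split, D-0116 arm; C15 / S-dbn-1 filler → kernel), monolith HOME/rh-splitx-eng-5/dbn/LinearRayCusp.lean; references: C. G. J. Jacobi (imaginary transformation of ϑ), B. Riemann / E. C. Titchmarsh §10.1 (Φ and Ξ), N. G. de Bruijn, Duke Math. J. 17 (1950) (Φ as analytic kernel).

FILING DELTA (lead RULING #49, flag F1, lean/CONVENTIONS.md §2): outer namespace `Summit.RiemannHypothesis.RiemannHypothesis.Theorems.Splittings.LinearRayCusp` added — `CuspTransform` and `LinearRayWideWindow` are nested inside it (namespace/`open` lines only; decl text unchanged).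
-/

noncomputable section

set_option linter.dupNamespace false

open Complex Real Set Filter Topology

namespace Summit.RiemannHypothesis.RiemannHypothesis.Theorems.Splittings.LinearRayCusp

namespace CuspTransform
/-! ## Stage D2: the top term's phase, norms of the other terms -/

/-- `e^{9iy} (x₀−i)^{−1/2} ((x₀−i)^4)⁻¹ = −s^{−1/2} s^{−4} · e^{iπ/8}` for `x₀ − i = s e^{−2iε}`, `y = π/8 − ε`. -/
theorem top_phase {s ε : ℝ} (hs : 0 < s) (hε1 : -π < -(2 * ε)) (hε2 : -(2 * ε) ≤ π) :
    cexp (9 * (I * ((π / 8 - ε : ℝ) : ℂ))) * ((((s : ℝ) : ℂ) * cexp (((-(2 * ε) : ℝ) : ℂ) * I)) ^ (((-(1 / 2) : ℝ) : ℝ) : ℂ)) *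
        (((((s : ℝ) : ℂ) * cexp (((-(2 * ε) : ℝ) : ℂ) * I)) ^ 4)⁻¹) =
      -((((s ^ (-(1 / 2) : ℝ) * (s ^ 4)⁻¹ : ℝ)) : ℂ) * c8) := by
  rw [ofReal_mul_cexp_cpow hs hε1 hε2]
  have hs' : ((s : ℝ) : ℂ) ≠ 0 := by exact_mod_cast hs.ne'
  -- ((s e^{iθ})^4)⁻¹ = s⁻⁴ e^{-4iθ}
  have h4 : ((((s : ℝ) : ℂ) * cexp (((-(2 * ε) : ℝ) : ℂ) * I)) ^ 4)⁻¹ =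
      (((s : ℂ)) ^ 4)⁻¹ * cexp (((8 * ε : ℝ) : ℂ) * I) := by
    rw [mul_pow, mul_inv, ← Complex.exp_nat_mul, ← Complex.exp_neg]
    congr 1; push_cast; ring_nf
  rw [h4, c8]
  -- collect the exponentials
  have key : cexp (9 * (I * ((π / 8 - ε : ℝ) : ℂ))) * cexp ((((-(1 / 2) * -(2 * ε)) : ℝ) : ℂ) * I) * cexp (((8 * ε : ℝ) : ℂ) * I)
      = -cexp (((π / 8 : ℝ) : ℂ) * I) := by
    rw [← Complex.exp_add, ← Complex.exp_add]
    have : 9 * (I * ((π / 8 - ε : ℝ) : ℂ)) + ((((-(1 / 2) * -(2 * ε)) : ℝ) : ℂ)) * I + ((8 * ε : ℝ) : ℂ) * I =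
        ((π / 8 : ℝ) : ℂ) * I + (π : ℂ) * I := by push_cast; ring
    rw [this, Complex.exp_add, Complex.exp_pi_mul_I]; ring
  calc cexp (9 * (I * ((π / 8 - ε : ℝ) : ℂ))) * ((((s ^ (-(1 / 2) : ℝ) : ℝ)) : ℂ) * cexp ((((-(1 / 2) * -(2 * ε)) : ℝ) : ℂ) * I)) *
        ((((s : ℂ)) ^ 4)⁻¹ * cexp (((8 * ε : ℝ) : ℂ) * I))
      = (((s ^ (-(1 / 2) : ℝ) : ℝ)) : ℂ) * (((s : ℂ)) ^ 4)⁻¹ *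
        (cexp (9 * (I * ((π / 8 - ε : ℝ) : ℂ))) * cexp ((((-(1 / 2) * -(2 * ε)) : ℝ) : ℂ) * I) * cexp (((8 * ε : ℝ) : ℂ) * I)) := by ring
    _ = -((((s ^ (-(1 / 2) : ℝ) * (s ^ 4)⁻¹ : ℝ)) : ℂ) * cexp (((π / 8 : ℝ) : ℂ) * I)) := by rw [key]; push_cast; ring

/-- norm of an inverse natural power of `s e^{iθ}`. -/
theorem norm_inv_pow_ofReal_mul_cexp {s θ : ℝ} (hs : 0 < s) (m : ℕ) :
    ‖((((s : ℝ) : ℂ) * cexp ((θ : ℂ) * I)) ^ m)⁻¹‖ = (s ^ m)⁻¹ := by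
  rw [norm_inv, norm_pow, norm_mul, Complex.norm_exp_ofReal_mul_I, mul_one, Complex.norm_real, Real.norm_of_nonneg hs.le]

/-- `‖e^{ik y}‖ = 1` for real `y`. -/
theorem norm_cexp_mul_I_mul (k : ℕ) (y : ℝ) : ‖cexp ((k : ℂ) * (I * (y : ℂ)))‖ = 1 := by
  rw [show (k : ℂ) * (I * (y : ℂ)) = (((k : ℝ) * y : ℝ) : ℂ) * I by push_cast; ring]
  exact Complex.norm_exp_ofReal_mul_I _

/-! ## Stage D3: abstract assembly inequality -/

/-- The expression `e9·H₂ + (3/2)e5·H₁` split as TOP + REST, with `Re ≤ Re TOP + ‖REST‖` and every norm bounded. -/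
theorem re_assembly_le (e9 e5 P1 P3 P5 Q2 Q3 Q4 G0' G1' G2' : ℂ) (t A s1 s3 s5 q2 q3 B0 B1 : ℝ)
    (he9 : ‖e9‖ = 1) (he5 : ‖e5‖ = 1) (hP1 : ‖P1‖ = s1) (hP3 : ‖P3‖ = s3) (hP5 : ‖P5‖ = s5)
    (hQ2 : ‖Q2‖ = q2) (hQ3 : ‖Q3‖ = q3) (hG0 : ‖G0'‖ ≤ B0) (hG1 : ‖G1'‖ ≤ B1)
    (htop : e9 * P1 * Q4 = -((t : ℂ) * c8)) (hA : A ≤ (c8 * G2').re) (ht : 0 ≤ t) :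
    (e9 * ((3 / 4 : ℂ) * P5 * G0' + P3 * Q2 * G1' + 2 * P1 * Q3 * G1' + P1 * Q4 * G2') +
        3 / 2 * e5 * (-(1 / 2 : ℂ) * P3 * G0' - P1 * Q2 * G1')).re ≤
      -(t * A) + (3 / 4 * s5 * B0 + s3 * q2 * B1 + 2 * s1 * q3 * B1 + 3 / 4 * s3 * B0 + 3 / 2 * s1 * q2 * B1) := by
  have hs1 : 0 ≤ s1 := hP1 ▸ norm_nonneg _
  have hs3 : 0 ≤ s3 := hP3 ▸ norm_nonneg _
  have hs5 : 0 ≤ s5 := hP5 ▸ norm_nonneg _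
  have hq2 : 0 ≤ q2 := hQ2 ▸ norm_nonneg _
  have hq3 : 0 ≤ q3 := hQ3 ▸ norm_nonneg _
  set TOP : ℂ := e9 * P1 * Q4 * G2' with hTOP
  set REST : ℂ := e9 * ((3 / 4 : ℂ) * P5 * G0') + e9 * (P3 * Q2 * G1') + e9 * (2 * P1 * Q3 * G1') +
      (3 / 2 * e5 * (-(1 / 2 : ℂ) * P3 * G0')) + (3 / 2 * e5 * (-(P1 * Q2 * G1'))) with hREST
  have hsplit : e9 * ((3 / 4 : ℂ) * P5 * G0' + P3 * Q2 * G1' + 2 * P1 * Q3 * G1' + P1 * Q4 * G2') +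
      3 / 2 * e5 * (-(1 / 2 : ℂ) * P3 * G0' - P1 * Q2 * G1') = TOP + REST := by
    rw [hTOP, hREST]; ring
  rw [hsplit, Complex.add_re]
  have hT : TOP.re = -(t * (c8 * G2').re) := by
    rw [hTOP, htop]
    rw [show -((t : ℂ) * c8) * G2' = -((t : ℂ) * (c8 * G2')) by ring, Complex.neg_re, Complex.re_ofReal_mul]
  have hR : REST.re ≤ ‖REST‖ := Complex.re_le_norm REST
  have hRn : ‖REST‖ ≤ 3 / 4 * s5 * B0 + s3 * q2 * B1 + 2 * s1 * q3 * B1 + 3 / 4 * s3 * B0 + 3 / 2 * s1 * q2 * B1 := by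
    rw [hREST]
    have n1 : ‖e9 * ((3 / 4 : ℂ) * P5 * G0')‖ ≤ 3 / 4 * s5 * B0 := by
      rw [norm_mul, norm_mul, norm_mul, he9, hP5, one_mul]
      have : ‖(3 / 4 : ℂ)‖ = 3 / 4 := by norm_num [Complex.norm_div]
      rw [this]; exact mul_le_mul_of_nonneg_left hG0 (by positivity)
    have n2 : ‖e9 * (P3 * Q2 * G1')‖ ≤ s3 * q2 * B1 := by
      rw [norm_mul, norm_mul, norm_mul, he9, hP3, hQ2, one_mul]
      exact mul_le_mul_of_nonneg_left hG1 (by positivity)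
    have n3 : ‖e9 * (2 * P1 * Q3 * G1')‖ ≤ 2 * s1 * q3 * B1 := by
      rw [norm_mul, norm_mul, norm_mul, norm_mul, he9, hP1, hQ3, one_mul, Complex.norm_ofNat]
      exact mul_le_mul_of_nonneg_left hG1 (by positivity)
    have n4 : ‖3 / 2 * e5 * (-(1 / 2 : ℂ) * P3 * G0')‖ ≤ 3 / 4 * s3 * B0 := by
      rw [norm_mul, norm_mul, norm_mul, norm_mul, he5, hP3, norm_neg, mul_one]
      have a : ‖(3 / 2 : ℂ)‖ = 3 / 2 := by norm_num [Complex.norm_div]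
      have b : ‖(1 / 2 : ℂ)‖ = 1 / 2 := by norm_num [Complex.norm_div]
      rw [a, b]
      have := mul_le_mul_of_nonneg_left hG0 (show (0:ℝ) ≤ 3 / 2 * (1 / 2 * s3) by positivity)
      linarith
    have n5 : ‖3 / 2 * e5 * (-(P1 * Q2 * G1'))‖ ≤ 3 / 2 * s1 * q2 * B1 := by
      rw [norm_mul, norm_mul, norm_neg, norm_mul, norm_mul, he5, hP1, hQ2, mul_one]
      have a : ‖(3 / 2 : ℂ)‖ = 3 / 2 := by norm_num [Complex.norm_div]
      rw [a]
      have := mul_le_mul_of_nonneg_left hG1 (show (0:ℝ) ≤ 3 / 2 * (s1 * q2) by positivity)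
      linarith
    calc _ ≤ ‖e9 * ((3 / 4 : ℂ) * P5 * G0') + e9 * (P3 * Q2 * G1') + e9 * (2 * P1 * Q3 * G1') +
          (3 / 2 * e5 * (-(1 / 2 : ℂ) * P3 * G0'))‖ + ‖3 / 2 * e5 * (-(P1 * Q2 * G1'))‖ := norm_add_le _ _
      _ ≤ (‖e9 * ((3 / 4 : ℂ) * P5 * G0') + e9 * (P3 * Q2 * G1') + e9 * (2 * P1 * Q3 * G1')‖ +
          ‖3 / 2 * e5 * (-(1 / 2 : ℂ) * P3 * G0')‖) + ‖3 / 2 * e5 * (-(P1 * Q2 * G1'))‖ := by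
          gcongr; exact norm_add_le _ _
      _ ≤ ((‖e9 * ((3 / 4 : ℂ) * P5 * G0') + e9 * (P3 * Q2 * G1')‖ + ‖e9 * (2 * P1 * Q3 * G1')‖) +
          ‖3 / 2 * e5 * (-(1 / 2 : ℂ) * P3 * G0')‖) + ‖3 / 2 * e5 * (-(P1 * Q2 * G1'))‖ := by
          gcongr; exact norm_add_le _ _
      _ ≤ (((‖e9 * ((3 / 4 : ℂ) * P5 * G0')‖ + ‖e9 * (P3 * Q2 * G1')‖) + ‖e9 * (2 * P1 * Q3 * G1')‖) +
          ‖3 / 2 * e5 * (-(1 / 2 : ℂ) * P3 * G0')‖) + ‖3 / 2 * e5 * (-(P1 * Q2 * G1'))‖ := by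
          gcongr; exact norm_add_le _ _
      _ ≤ _ := by linarith
  have : -(t * (c8 * G2').re) ≤ -(t * A) := by
    have := mul_le_mul_of_nonneg_left hA ht; linarith
  linarith

/-! ## Stage D4: numerics and the sign theorem -/

/-- `e^{−a} ≤ 2^{−n}` for `a ≥ n` (crude, `e > 2`). -/
theorem exp_neg_le_two_pow_neg {a : ℝ} {n : ℕ} (ha : (n : ℝ) ≤ a) : Real.exp (-a) ≤ (2 : ℝ)⁻¹ ^ n := by
  have h1 : Real.exp (-a) ≤ Real.exp (-(n : ℝ)) := Real.exp_le_exp.2 (by linarith)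
  have h2 : Real.exp (-(n : ℝ)) = (Real.exp 1)⁻¹ ^ n := by
    rw [← Real.exp_neg, ← Real.exp_nat_mul]; ring_nf
  have h3 : (Real.exp 1)⁻¹ ≤ (2 : ℝ)⁻¹ := by
    have := Real.exp_one_gt_d9
    exact inv_anti₀ (by norm_num) (by linarith)
  calc Real.exp (-a) ≤ (Real.exp 1)⁻¹ ^ n := h1.trans h2.le
    _ ≤ (2 : ℝ)⁻¹ ^ n := pow_le_pow_left₀ (by positivity) h3 n

/-- tail ratio bound: for `π K ≥ 28` and `k ≤ 2`, `r_k/(1 − r_k) ≤ 2 · 2⁻²⁴` with `r_k = e^{−(πK − 2k)}`. -/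
theorem tail_ratio_le {K : ℝ} (hK : 28 ≤ π * K) {k : ℕ} (hk : k ≤ 2) :
    Real.exp (-(π * K - 2 * k)) / (1 - Real.exp (-(π * K - 2 * k))) ≤ 2 * (2 : ℝ)⁻¹ ^ 24 := by
  have hk' : (k : ℝ) ≤ 2 := by exact_mod_cast hk
  have hr : Real.exp (-(π * K - 2 * k)) ≤ (2 : ℝ)⁻¹ ^ 24 :=
    exp_neg_le_two_pow_neg (n := 24) (by push_cast; linarith)
  have hr0 : 0 ≤ Real.exp (-(π * K - 2 * k)) := (Real.exp_pos _).le
  have hsmall : (2 : ℝ)⁻¹ ^ 24 ≤ 1 / 2 := by norm_num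
  have hden : 1 / 2 ≤ 1 - Real.exp (-(π * K - 2 * k)) := by linarith
  rw [div_le_iff₀ (by linarith)]
  nlinarith

/-- wrappers with the exponent literals as they appear in `H1`/`H2` -/
theorem norm_cpow_m12 {s θ : ℝ} (hs : 0 < s) (h1 : -π < θ) (h2 : θ ≤ π) :
    ‖(((s : ℝ) : ℂ) * cexp ((θ : ℂ) * I)) ^ (-(1 / 2 : ℂ))‖ = s ^ (-(1 / 2) : ℝ) := by
  have := norm_ofReal_mul_cexp_cpow (p := -(1 / 2)) hs h1 h2; push_cast at this; exact this
/-- Norm of `(s e^{iθ})^{−3/2}`. -/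
theorem norm_cpow_m32 {s θ : ℝ} (hs : 0 < s) (h1 : -π < θ) (h2 : θ ≤ π) :
    ‖(((s : ℝ) : ℂ) * cexp ((θ : ℂ) * I)) ^ (-(3 / 2 : ℂ))‖ = s ^ (-(3 / 2) : ℝ) := by
  have := norm_ofReal_mul_cexp_cpow (p := -(3 / 2)) hs h1 h2; push_cast at this; exact this
/-- Norm of `(s e^{iθ})^{−5/2}`. -/
theorem norm_cpow_m52 {s θ : ℝ} (hs : 0 < s) (h1 : -π < θ) (h2 : θ ≤ π) :
    ‖(((s : ℝ) : ℂ) * cexp ((θ : ℂ) * I)) ^ (-(5 / 2 : ℂ))‖ = s ^ (-(5 / 2) : ℝ) := by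
  have := norm_ofReal_mul_cexp_cpow (p := -(5 / 2)) hs h1 h2; push_cast at this; exact this
/-- `top_phase` with the exponent literal `-(1/2 : ℂ)` as it appears in `H1`/`H2`. -/
theorem top_phase' {s ε : ℝ} (hs : 0 < s) (hε1 : -π < -(2 * ε)) (hε2 : -(2 * ε) ≤ π) :
    cexp (9 * (I * ((π / 8 - ε : ℝ) : ℂ))) * ((((s : ℝ) : ℂ) * cexp (((-(2 * ε) : ℝ) : ℂ) * I)) ^ (-(1 / 2 : ℂ))) *
        (((((s : ℝ) : ℂ) * cexp (((-(2 * ε) : ℝ) : ℂ) * I)) ^ 4)⁻¹) =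
      -((((s ^ (-(1 / 2) : ℝ) * (s ^ 4)⁻¹ : ℝ)) : ℂ) * c8) := by
  have := top_phase hs hε1 hε2; push_cast at this ⊢; exact this

/-- The tail ratio `r_k/(1 − r_k)` is non-negative for `πK ≥ 28`, `k ≤ 2`. -/
theorem tail_ratio_nonneg {K : ℝ} (hK : 28 ≤ π * K) {k : ℕ} (hk : k ≤ 2) :
    0 ≤ Real.exp (-(π * K - 2 * k)) / (1 - Real.exp (-(π * K - 2 * k))) := by
  have hk' : (k : ℝ) ≤ 2 := by exact_mod_cast hk
  have hr : Real.exp (-(π * K - 2 * k)) ≤ 1 / 2 :=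
    (exp_neg_le_two_pow_neg (n := 24) (by push_cast; linarith)).trans (by norm_num)
  exact div_nonneg (Real.exp_pos _).le (by linarith)

/-- the final numeric inequality, in exactly the shape produced by `re_assembly_le` with the bounds
`norm_G_W0_le (k = 0, 1)` and `re_c8_mul_G_two_ge` (tail ratios abstracted as `ρ0 ρ1 ρ2`). -/
theorem numeric_final {s K ρ0 ρ1 ρ2 : ℝ} (hs0 : 0 < s) (hs1 : s ≤ 171 / 1000)
    (hρ0' : 0 ≤ ρ0) (hρ1' : 0 ≤ ρ1)
    (t0 : ρ0 ≤ 2 * (2 : ℝ)⁻¹ ^ 24) (t1 : ρ1 ≤ 2 * (2 : ℝ)⁻¹ ^ 24) (t2 : ρ2 ≤ 2 * (2 : ℝ)⁻¹ ^ 24) :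
    -(s ^ (-(1 / 2) : ℝ) * (s ^ 4)⁻¹ * (2 * Real.exp (-(π * K / 8)) * ((π / 4) ^ 2 - (4 * π) ^ 2 * ρ2))) +
      (3 / 4 * s ^ (-(5 / 2) : ℝ) * (2 * Real.exp (-(π * K / 8)) * ((π / 4) ^ 0 + (4 * π) ^ 0 * ρ0)) +
        s ^ (-(3 / 2) : ℝ) * (s ^ 2)⁻¹ * (2 * Real.exp (-(π * K / 8)) * ((π / 4) ^ 1 + (4 * π) ^ 1 * ρ1)) +
        2 * s ^ (-(1 / 2) : ℝ) * (s ^ 3)⁻¹ * (2 * Real.exp (-(π * K / 8)) * ((π / 4) ^ 1 + (4 * π) ^ 1 * ρ1)) +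
        3 / 4 * s ^ (-(3 / 2) : ℝ) * (2 * Real.exp (-(π * K / 8)) * ((π / 4) ^ 0 + (4 * π) ^ 0 * ρ0)) +
        3 / 2 * s ^ (-(1 / 2) : ℝ) * (s ^ 2)⁻¹ * (2 * Real.exp (-(π * K / 8)) * ((π / 4) ^ 1 + (4 * π) ^ 1 * ρ1))) < 0 := by
  have hπlo := Real.pi_gt_d4
  have hπhi := Real.pi_lt_d4
  set u := s ^ (-(1 / 2) : ℝ) with hu_def
  set E := Real.exp (-(π * K / 8)) with hE
  have hu : 0 < u := Real.rpow_pos_of_pos hs0 _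
  have hE0 : 0 < E := Real.exp_pos _
  have e32 : s ^ (-(3 / 2) : ℝ) = u * s⁻¹ := by
    rw [hu_def, show (-(3 / 2) : ℝ) = -(1 / 2) + (-1) by norm_num, Real.rpow_add hs0, Real.rpow_neg_one]
  have e52 : s ^ (-(5 / 2) : ℝ) = u * (s ^ 2)⁻¹ := by
    rw [hu_def, show (-(5 / 2) : ℝ) = -(1 / 2) + (-2) by norm_num, Real.rpow_add hs0]
    congr 1
    rw [show (-2 : ℝ) = -((2 : ℕ) : ℝ) by norm_num, Real.rpow_neg hs0.le, Real.rpow_natCast]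
  rw [e32, e52]
  simp only [pow_zero, pow_one, one_mul]
  have hsm : (2 : ℝ) * (2 : ℝ)⁻¹ ^ 24 ≤ 1 / 8000000 := by norm_num
  have hs2 : s ^ 2 ≤ 293 / 10000 := by nlinarith
  have hs3 : s ^ 3 ≤ 51 / 10000 := by nlinarith
  have hq1 : π / 4 + 4 * π * ρ1 ≤ 7855 / 10000 := by nlinarith
  have hq1' : 0 ≤ π / 4 + 4 * π * ρ1 := by nlinarith
  have hq0 : 1 + ρ0 ≤ 10001 / 10000 := by linarith
  have hq0' : 0 ≤ 1 + ρ0 := by linarith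
  have hq2 : 6167 / 10000 ≤ (π / 4) ^ 2 - (4 * π) ^ 2 * ρ2 := by nlinarith
  have m1 : s ^ 2 * (1 + ρ0) ≤ 293 / 10000 * (10001 / 10000) := mul_le_mul hs2 hq0 hq0' (by norm_num)
  have m2 : s * (π / 4 + 4 * π * ρ1) ≤ 171 / 1000 * (7855 / 10000) := mul_le_mul hs1 hq1 hq1' (by norm_num)
  have m3 : s ^ 3 * (1 + ρ0) ≤ 51 / 10000 * (10001 / 10000) := mul_le_mul hs3 hq0 hq0' (by norm_num)
  have m4 : s ^ 2 * (π / 4 + 4 * π * ρ1) ≤ 293 / 10000 * (7855 / 10000) := mul_le_mul hs2 hq1 hq1' (by norm_num)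
  have key : -2 * ((π / 4) ^ 2 - (4 * π) ^ 2 * ρ2) + 2 * (3 / 4 * (s ^ 2 * (1 + ρ0)) + s * (π / 4 + 4 * π * ρ1) +
      2 * (s * (π / 4 + 4 * π * ρ1)) + 3 / 4 * (s ^ 3 * (1 + ρ0)) + 3 / 2 * (s ^ 2 * (π / 4 + 4 * π * ρ1))) < 0 := by
    linarith
  have hs0' : s ≠ 0 := hs0.ne'
  have expr : -(u * (s ^ 4)⁻¹ * (2 * E * ((π / 4) ^ 2 - (4 * π) ^ 2 * ρ2))) +
      (3 / 4 * (u * (s ^ 2)⁻¹) * (2 * E * (1 + ρ0)) + u * s⁻¹ * (s ^ 2)⁻¹ * (2 * E * (π / 4 + 4 * π * ρ1)) +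
        2 * u * (s ^ 3)⁻¹ * (2 * E * (π / 4 + 4 * π * ρ1)) + 3 / 4 * (u * s⁻¹) * (2 * E * (1 + ρ0)) +
        3 / 2 * u * (s ^ 2)⁻¹ * (2 * E * (π / 4 + 4 * π * ρ1))) =
      (u * E * (s ^ 4)⁻¹) * (-2 * ((π / 4) ^ 2 - (4 * π) ^ 2 * ρ2) + 2 * (3 / 4 * (s ^ 2 * (1 + ρ0)) +
        s * (π / 4 + 4 * π * ρ1) + 2 * (s * (π / 4 + 4 * π * ρ1)) + 3 / 4 * (s ^ 3 * (1 + ρ0)) +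
        3 / 2 * (s ^ 2 * (π / 4 + 4 * π * ρ1)))) := by
    field_simp
  rw [expr]
  exact mul_neg_of_pos_of_neg (by positivity) key

open Summit.RiemannHypothesis.RiemannHypothesis.Theorems.UniversalFactor in
/-- **The sign of the residue series near the cusp**: `Re Σ_{m≥1} s_m(π/8 − ε) < 0` for `0 < ε ≤ 0.0427`
(i.e. `0.35 ≤ y < π/8`). -/
theorem re_tsum_term_neg_eps {ε : ℝ} (hε0 : 0 < ε) (hε1 : ε ≤ 427 / 10000) :
    (∑' n : ℕ, PhiICert.term (n + 1) (π / 8 - ε)).re < 0 := by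
  have hπlo := Real.pi_gt_d4
  have hπhi := Real.pi_lt_d4
  have h2ε0 : 0 < 2 * ε := by linarith
  have h2ε1 : 2 * ε ≤ 854 / 10000 := by linarith
  have hsin0 : 0 < Real.sin (2 * ε) := Real.sin_pos_of_pos_of_lt_pi h2ε0 (by linarith)
  have hsinle : Real.sin (2 * ε) ≤ 2 * ε := Real.sin_le h2ε0.le
  have hcosge : 1 - (2 * ε) ^ 2 / 2 ≤ Real.cos (2 * ε) := Real.one_sub_sq_div_two_le_cos
  have hcos0 : 0 < Real.cos (2 * ε) := by nlinarith
  set s : ℝ := 2 * Real.sin (2 * ε) with hsdef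
  have hs0 : 0 < s := by rw [hsdef]; linarith
  have hs1 : s ≤ 171 / 1000 := by rw [hsdef]; linarith
  set K : ℝ := Real.cos (2 * ε) / Real.sin (2 * ε) with hKdef
  have hK0 : 0 < K := by rw [hKdef]; exact div_pos hcos0 hsin0
  have hK28 : 28 ≤ π * K := by
    rw [hKdef, mul_div_assoc', le_div_iff₀ hsin0]
    nlinarith
  have hK2 : K / 2 = Real.cos (2 * ε) / (2 * Real.sin (2 * ε)) := by
    rw [hKdef]; field_simp
  have hyabs : |π / 8 - ε| < π / 8 := by rw [abs_lt]; constructor <;> linarith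
  have hx : 0 < (cexp (4 * (I * ((π / 8 - ε : ℝ) : ℂ)))).re := re_cexp_four_I_pos hyabs
  have ha := cexp_four_I_sub_I ε
  have hW : (cexp (4 * (I * ((π / 8 - ε : ℝ) : ℂ))) - I)⁻¹ = W0 K := by
    rw [inv_cexp_four_I_sub_I hsin0.ne', W0, hK2]
  have hθ1 : -π < -(2 * ε) := by linarith
  have hθ2 : -(2 * ε) ≤ π := by linarith
  rw [tsum_term_eq hyabs, F_two_eq_H2 hx, F_one_eq_H1 hx]
  simp only [H1, H2]
  rw [hW, ha]
  have hk0 : 2 * ((0 : ℕ) : ℝ) < π * K := by push_cast; linarith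
  have hk1 : 2 * ((1 : ℕ) : ℝ) < π * K := by push_cast; linarith
  have hk2 : 2 * ((2 : ℕ) : ℝ) < π * K := by push_cast; linarith
  have hB0 := norm_G_W0_le hK0 0 hk0
  have hB1 := norm_G_W0_le hK0 1 hk1
  have hA := re_c8_mul_G_two_ge hK0 hk2
  have hmain := re_assembly_le (cexp (9 * (I * ((π / 8 - ε : ℝ) : ℂ)))) (cexp (5 * (I * ((π / 8 - ε : ℝ) : ℂ))))
    ((((s : ℝ) : ℂ) * cexp (((-(2 * ε) : ℝ) : ℂ) * I)) ^ (-(1 / 2 : ℂ)))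
    ((((s : ℝ) : ℂ) * cexp (((-(2 * ε) : ℝ) : ℂ) * I)) ^ (-(3 / 2 : ℂ)))
    ((((s : ℝ) : ℂ) * cexp (((-(2 * ε) : ℝ) : ℂ) * I)) ^ (-(5 / 2 : ℂ)))
    (((((s : ℝ) : ℂ) * cexp (((-(2 * ε) : ℝ) : ℂ) * I)) ^ 2)⁻¹)
    (((((s : ℝ) : ℂ) * cexp (((-(2 * ε) : ℝ) : ℂ) * I)) ^ 3)⁻¹)
    (((((s : ℝ) : ℂ) * cexp (((-(2 * ε) : ℝ) : ℂ) * I)) ^ 4)⁻¹)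
    (G 0 (W0 K)) (G 1 (W0 K)) (G 2 (W0 K))
    (s ^ (-(1 / 2) : ℝ) * (s ^ 4)⁻¹) _ (s ^ (-(1 / 2) : ℝ)) (s ^ (-(3 / 2) : ℝ)) (s ^ (-(5 / 2) : ℝ))
    ((s ^ 2)⁻¹) ((s ^ 3)⁻¹) _ _
    (by simpa using norm_cexp_mul_I_mul 9 (π / 8 - ε)) (by simpa using norm_cexp_mul_I_mul 5 (π / 8 - ε))
    (norm_cpow_m12 hs0 hθ1 hθ2) (norm_cpow_m32 hs0 hθ1 hθ2) (norm_cpow_m52 hs0 hθ1 hθ2)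
    (norm_inv_pow_ofReal_mul_cexp hs0 2) (norm_inv_pow_ofReal_mul_cexp hs0 3)
    hB0 hB1 (top_phase' hs0 hθ1 hθ2) hA (by positivity)
  exact lt_of_le_of_lt hmain (numeric_final hs0 hs1 (tail_ratio_nonneg hK28 (k := 0) (by norm_num))
    (tail_ratio_nonneg hK28 (k := 1) (by norm_num))
    (tail_ratio_le hK28 (k := 0) (by norm_num)) (tail_ratio_le hK28 (k := 1) (by norm_num))
    (tail_ratio_le hK28 (k := 2) (by norm_num)))

open Summit.RiemannHypothesis.RiemannHypothesis.Theorems.UniversalFactor in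
/-- The same statement for `y ∈ [0.35, π/8)`. -/
theorem re_tsum_term_neg_of_ge {y : ℝ} (hy1 : 35 / 100 ≤ y) (hy2 : y < π / 8) :
    (∑' n : ℕ, PhiICert.term (n + 1) y).re < 0 := by
  have hπhi := Real.pi_lt_d4
  have h := re_tsum_term_neg_eps (ε := π / 8 - y) (by linarith) (by linarith)
  rwa [show π / 8 - (π / 8 - y) = y by ring] at h

end CuspTransform

/-! ## Corollaries: the wide-window residue and the linear ray on `0.31945 ≤ |a| < π/8` -/

namespace LinearRayWideWindow

open Summit.RiemannHypothesis.RiemannHypothesis.Theorems.Splittings.LinearRayWideWindow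

open Complex MeasureTheory Set
open Literature.NumberTheory.LFunctions
open Literature.Barriers.RiemannHypothesis (linearFactorH)
open Summit.RiemannHypothesis.RiemannHypothesis.Theorems.Splittings.ResidueSignCells

/-- `Re Φ_ℂ(iy) < 0` on the WHOLE upper window `0.31945 ≤ y < π/8`: the tree's 34 kernel theta cells on
`[0.31945, 0.37]` and the cusp transformation (`CuspTransform.re_tsum_term_neg_of_ge`) on `[0.35, π/8)`. -/
theorem re_tsum_neg_upper {y : ℝ} (h0 : 31945 / 100000 ≤ y) (h1 : y < Real.pi / 8) :
    (∑' n : ℕ, UniversalFactor.PhiICert.term (n + 1) y).re < 0 := by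
  rcases le_or_gt y (37 / 100) with h | h
  · exact re_tsum_neg_mid h0 h
  · exact CuspTransform.re_tsum_term_neg_of_ge (by linarith) h1

/-- The wide-window residue `∫₀^∞ H_0 cosh(a·)` is non-zero for every `0.31945 ≤ |a| < π/8`. -/
theorem coshIntegral_ne_zero_of_upper {a : ℝ} (h0 : 31945 / 100000 ≤ |a|) (h1 : |a| < Real.pi / 8) :
    (∫ x in Ioi (0:ℝ), deBruijnH 0 (x : ℂ) * (Real.cosh (a * x) : ℂ)) ≠ 0 := by
  have hlt : |(|a|)| < Real.pi / 8 := by rwa [abs_abs]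
  have hcert := UniversalFactor.coshIntegral_ne_zero_of_re_tsum_ne_zero hlt (re_tsum_neg_upper h0 h1).ne
  rcases abs_choice a with h | h
  · rwa [h] at hcert
  · simpa only [h, neg_mul, Real.cosh_neg] using hcert

/-- **The linear ray is refuted on the whole wide window above the gap**: for every `0.31945 ≤ |a| < π/8`,
`linearFactorH a` has a non-real zero.  Together with `not_hasOnlyRealZeros_linearFactorH_of_abs_le_ext`
(`0 < |a| ≤ 0.31935`) this leaves only the `10⁻⁴` gap around the residue zero `a₀ = 0.3194…` and `|a| ≥ π/8`. -/
theorem not_hasOnlyRealZeros_linearFactorH_of_upper {a : ℝ} (h0 : 31945 / 100000 ≤ |a|)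
    (h1 : |a| < Real.pi / 8) : ¬ HasOnlyRealZeros (linearFactorH a) :=
  not_hasOnlyRealZeros_linearFactorH_of_coshIntegral_ne_zero
    (abs_pos.1 (lt_of_lt_of_le (by norm_num) h0)) h1 (coshIntegral_ne_zero_of_upper h0 h1)

/-- **Summary on `0 < |a| < π/8` outside the gap `(0.31935, 0.31945)`**: a non-real zero of `linearFactorH a`. -/
theorem exists_nonreal_zero_linearFactorH_of_lt_pi_div_eight {a : ℝ} (ha : a ≠ 0) (h1 : |a| < Real.pi / 8)
    (hgap : |a| ≤ 31935 / 100000 ∨ 31945 / 100000 ≤ |a|) :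
    ∃ z : ℂ, linearFactorH a z = 0 ∧ z.im ≠ 0 := by
  have h : ¬ HasOnlyRealZeros (linearFactorH a) := by
    rcases hgap with h | h
    · exact not_hasOnlyRealZeros_linearFactorH_of_abs_le_ext ha h
    · exact not_hasOnlyRealZeros_linearFactorH_of_upper h h1
  unfold HasOnlyRealZeros at h
  push Not at h
  exact h

end LinearRayWideWindow

end Summit.RiemannHypothesis.RiemannHypothesis.Theorems.Splittings.LinearRayCusp
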